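import Summits.QuantumFields.BalabanUV.Beta.D1BFx.NeedleNdlNdlPairings
import Summits.QuantumFields.BalabanUV.Beta.D1BFx.GluonNeedleGlue
import Summits.QuantumFields.BalabanUV.Beta.D1BFx.GluonLegProfile
import Summits.QuantumFields.BalabanUV.Beta.D1BFx.NeedleNdlNdlCensus
import Summits.QuantumFields.BalabanUV.Beta.D1BFx.NeedleGhostBubble2Row

/-!
# `BalabanUV.Beta.D1BFx.NeedleNdlNdlRow` — road «BF-x» for binder row D1, slot (K), END row `hGrp gN`, «GN-33 ∕ NN»: THE `ndlPiece ⊗ ndlPiece` CELL OF THE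
# GLUON NEEDLE ROW T₃ IS n-UNIFORM — `|cellSum n a (ndlPiece n a (cQ n)) (ndlPiece n a (cQ n)) μ ν| ≤ C` for every `n ≥ 1`, ONE `C ≥ 0`, modulo
# [B5, Prop. 1.2] ∧ [B5, (1.126)–(1.127)] BY NAME and a uniform bound `|cQ n| ≤ cQ₀` on the column weight (P13) — the hypothesis `hnn` of
# `GluonNeedleGlue.h₃_of_cells` (an3-g57 §3′ (4) «R3⊗R3 … n⁰, every (λ, λ′)»; log-FREE, no cancellation)

HONEST DEPENDENCY (cell records, verbatim): «continuum YM on T⁴ ⇐ BetaPertH ∧ nine spine estimates (0/9 proved); BetaPertH ⇐ (D1) ∧ (D4) ∧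
CAP+tail; G-an2-4 gates asym, D1 and NE2/3/4.»  HONEST FRAMING (cell contract, verbatim): «discharging `BetaPertH` makes Bałaban's UV stability
UNCONDITIONAL — a real constructive-QFT result; it is NOT the continuum limit and NOT the Clay problem.»  THIS MODULE DISCHARGES NOTHING of the
wall: [folklore] bookkeeping BY NAME over the owner's «GN-NDL-SHAPE» (`NeedleNdlShape.ndlPiece_eq_dSw_tensor` ∕ `bubble_ndl_dSw` ∕ `locV_ndlRow` ∕
`locV_combinedColumn`, p263835), this lineage's pairing bounds (`NeedleNdlNdlPairings.exists_row_col_bound` ∕ `_col_row_` ∕ `_col_col_` ∕ `_row_row_`),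
the census `NeedleNdlNdlCensus` (M7 = `NeedleBondMarginal.sum_bond_abs_qJet_le` over blocks), the w-sum junction `NeedleGhostBubble2Row.abs_fullSum_weight_le_of_blockDecay_mass`,
leaf-04-g9's `GluonLegProfile.exists_abs_Ga_le_profile`, leaf-03's
`GluonLegTails.spr_Ga_of_prop12`.  No `def`, no `def … : Prop`, nothing cited, 0 sorry; the printed statements are HYPOTHESES by name.
Root-level binders hW ∕ hR-sockets ∕ hSX-socket ∕ D1Tel ∕ D1Rep — 0 discharged; (K) NOT closed (with PP: 2∕9 cells of T₃); NOT D1, NOT `BetaPertH`, NOT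
continuum, NOT Clay.

ABSOLUTE RULE (cell charter, verbatim): «No internally-minted statement may enter as a cited fact. Every hypothesis is either kernel-proved in
this package or a verbatim quotation of a PUBLISHED theorem with page reference. The manuscript(s) under audit are NOT citable for their own
disputed steps — they are the thing under adjudication; programme-internal (2001/route/tribunal) claims are never citable.»

WHY (owner claim table «GN-CELLS» = `HOME/b2b-balaban-beta-d1-p2/GLUON-NEEDLE-ROWS.md` v0.2, R3 cell `ndl ⊗ ndl`; an3-g57 `N36-SPLIT.v1.md` §3′ (4)
«R3⊗R3 (needle ⊗ needle): `β = 𝔅(C,row′)𝔅(C′,row) − 𝔅(C,C′)𝔅(row,row′) − (transposes)` … Both pairings: `n^{λ+λ′−6}` per pair ⇒ × `n^{6−λ′}` × `n^{−λ}` = n⁰,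
every (λ, λ′) … `T₃[R3⊗R3] ≤ 2N²·k·n⁻²·(Σ_{b∈block} w_b)²·K(δ)`»; MINE journal 2026-08-21 l.30734).  Per pair of bonds (partner `(μ, b+w)`, base `(ν, b)`):
`|word| ≤ K·e^{−(δ∕4)·dist(blk(b+w), blk b)}·(W_{b+w}·W_b + n·M(b+w,b))` (§1; `W` the needle weight, `M` the two-needle Coulomb functional); block sums
`Σ_{p∈B(β)} (W_p·W_b + n·M(p,b)) ≤ (1 + c₁)·n·W_b` by M7 (§2); the w-sum `≤ K′·n³·W_b` (block decay × block mass); the base average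
`n⁻⁴·Σ_b K′n³W_b ≤ K′·(n−1)∕n` (M7 on the base block): n⁰.  The logarithm of §3′'s profile-level count is absent: it was traded in
`NeedleHLSGain` for the power `n∕nrm(s−s′)`, which M7 and `Σ_{s∈B(β)} nrm(s−s′)⁻¹ ≤ c₁n³` absorb.

CONTENT (`a > 0`; `C_u q = cQ·Σ_{z∈B(blk u)} Pgt n a z q − kerP (n−1) a q (blk u)` spelled out).
* §1 [folklore] `sum_sum_div_nrm_comm` (`M(u,p) = M(p,u)`), **`abs_word_le_of_pairings`** — the `ndl ⊗ ndl` word from the four pairing bounds (abstract `K`'s).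
* §2 [folklore] **`exists_ndlNdl_row_le`** — `∃ C ≥ 0, ∀ n [NeZero n], |cellSum n a (ndlPiece n a (cQ n)) (ndlPiece n a (cQ n)) μ ν| ≤ C` modulo `h12`∕`h126`,
  `|cQ n| ≤ cQ₀`; `hnn_of_prop12` — the `2 ≤ n` hypothesis shape of `h₃_of_cells` verbatim.
NOT HERE (honest): the cells NK∕KN (dipole letters), NP∕PN (leaf-01), KK∕PK∕KP (leaf-04); T₁∕T₂; the glue.
Unit `b2b-balaban-gan24-formalise-leaf-05` (gen 42), G-an2-4 swarm leaf prover on cross-lane kernel duty; `LEAVES-BFx.md` row (N) «GN-33∕NN».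
-/

noncomputable section

namespace Summit.QuantumFields.BalabanUV.Beta.D1BFx.NeedleNdlNdlRow

open Finset Filter Topology
open scoped BigOperators
open Literature.MathematicalPhysics.QuantumFieldTheory.Balaban1983to89
open Literature.MathematicalPhysics.QuantumFieldTheory.Balaban1983to89.Beta
open B4Sect5Proof (latticeConst latticeConst_nonneg)
open B6QGQLower276 (X e blk B mem_B side chart chart_mem_B dist_le_of_blk_eq)
open B6QGQDecay237 (card_B)
open ExpKernelCalculus (Site MKer bubble)
open Beta.PoissonInterior (nrm nrm_pos nrm_neg)
open DyadicShell (Pt toReal toReal_apply)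
open WindowIdentification (fullSum)
open DressedMomentNormalisation (resSite)
open VectorTailsLoc (fam kfam)
open Summit.QuantumFields.BalabanUV.Beta.TameKernelCalculus (Spr)
open Summit.QuantumFields.BalabanUV.Beta.D1BFx.PackedKernelSplit (bubble_eq_biBubble)
open Summit.QuantumFields.BalabanUV.Beta.D1BFx.FineHessianSectors (biBubbleTable biBubbleTable_apply)
open Summit.QuantumFields.BalabanUV.Beta.D1BFx.RProjector (Pgt kerP deltaPP deltaP deltaPP_pos deltaP_pos)
open Summit.QuantumFields.BalabanUV.Beta.D1BFx.GluonLeg (Ga)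
open Summit.QuantumFields.BalabanUV.Beta.D1BFx.GluonLegTails (spr_Ga_of_prop12)
open Summit.QuantumFields.BalabanUV.Beta.D1BFx.GluonLegProfile (exists_abs_Ga_le_profile)
open Summit.QuantumFields.BalabanUV.Beta.D1BFx.FrozenLegTails (nOf MOf hn1)
open Summit.QuantumFields.BalabanUV.Beta.D1BFx.GhostLeg (cast_pred_add_one)
open Summit.QuantumFields.BalabanUV.Beta.D1BFx.GhostStencil (qJet)
open Summit.QuantumFields.BalabanUV.Beta.D1BFx.GhostLegFree (supNorm_eq)
open Summit.QuantumFields.BalabanUV.Beta.D1BFx.GhostLegBlockMass (dist_eq_supNorm)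
open Summit.QuantumFields.BalabanUV.Beta.D1BFx.GluonNeedleSplit (ndlPiece dSw_sub loc_ndlPiece)
open Summit.QuantumFields.BalabanUV.Beta.D1BFx.NeedlePotentialLetters (ndlRow)
open Summit.QuantumFields.BalabanUV.Beta.D1BFx.RColumnBlockMass (dR dR_pos)
open Summit.QuantumFields.BalabanUV.Beta.D1BFx.RankOneBubble (pairing applyK pairing_comm bubble_sub_right)
open Summit.QuantumFields.BalabanUV.Beta.D1BFx.RankOneBubbleJets (grad tensor dSw_tensor loc_dSw_tensor locV_grad_of_locV)
open Summit.QuantumFields.BalabanUV.Beta.D1BFx.RJetAssembly (dSw)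
open Summit.QuantumFields.BalabanUV.Beta.D1BFx.NeedleNdlShape (ndlPiece_eq_dSw_tensor bubble_ndl_dSw locV_ndlRow locV_combinedColumn)
open Summit.QuantumFields.BalabanUV.Beta.D1BFx.NeedleNdlNdlCensus (sum_B_W_le sum_B_M_le sum_resSite_W_le)
open Summit.QuantumFields.BalabanUV.Beta.D1BFx.NeedleGhostBubble2Row (abs_fullSum_weight_le_of_blockDecay_mass)
open Summit.QuantumFields.BalabanUV.Beta.D1BFx.GluonNeedleGlue (cellSum cellSum_def)
open Summit.QuantumFields.BalabanUV.Beta.D1BFx.NeedleNdlNdlPairings (exists_row_col_bound exists_col_row_bound exists_col_col_bound exists_row_row_bound)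

variable (n : ℕ) [NeZero n] {a : ℝ} (cQ : ℝ)

/-! ## §1 The `ndl ⊗ ndl` word from the four pairing bounds -/

/-- [folklore] the two-needle Coulomb functional is symmetric: `Σ_{s′∈T} Σ_{s∈S} g s′·f s∕nrm(s′−s) = Σ_{s∈S} Σ_{s′∈T} f s·g s′∕nrm(s−s′)`. -/
theorem sum_sum_div_nrm_comm (S T : Finset (Site 4)) (f g : Site 4 → ℝ) :
    ∑ s' ∈ T, ∑ s ∈ S, g s' * f s / nrm (s' - s) = ∑ s ∈ S, ∑ s' ∈ T, f s * g s' / nrm (s - s') := by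
  rw [Finset.sum_comm]
  refine Finset.sum_congr rfl fun s _ => Finset.sum_congr rfl fun s' _ => ?_
  rw [← nrm_neg (s' - s), neg_sub, mul_comm]

/-- [folklore] the arithmetic skeleton of the `ndl ⊗ ndl` word: eight pairings bounded by `Kα·E·W`, `Kβ·E·W`, `Kγ·X·E`, `Kδ·Y·M` (`E ≤ 1`) give
`|−½·(P₁P₂ − P₃P₄ − (P₅P₆ − P₇P₈))| ≤ E·((Kα² + Kβ²)·(W_p·W_u) + 2·Kγ·Kδ·(X·Y)·M)`. -/
theorem word_arith {P₁ P₂ P₃ P₄ P₅ P₆ P₇ P₈ Kα Kβ Kγ Kδ X Y E Wp Wu M : ℝ} (hKα : 0 ≤ Kα) (hKβ : 0 ≤ Kβ) (hKγ : 0 ≤ Kγ) (hKδ : 0 ≤ Kδ)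
    (hX : 0 ≤ X) (hY : 0 ≤ Y) (hE0 : 0 ≤ E) (hE1 : E ≤ 1) (hWp : 0 ≤ Wp) (hWu : 0 ≤ Wu) (hM : 0 ≤ M)
    (b1 : |P₁| ≤ Kα * E * Wp) (b2 : |P₂| ≤ Kα * E * Wu) (b3 : |P₃| ≤ Kγ * X * E) (b4 : |P₄| ≤ Kδ * Y * M)
    (b5 : |P₅| ≤ Kδ * Y * M) (b6 : |P₆| ≤ Kγ * X * E) (b7 : |P₇| ≤ Kβ * E * Wu) (b8 : |P₈| ≤ Kβ * E * Wp) :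
    |-(1 / 2 : ℝ) * (P₁ * P₂ - P₃ * P₄ - (P₅ * P₆ - P₇ * P₈))| ≤ E * ((Kα * Kα + Kβ * Kβ) * (Wp * Wu) + 2 * Kγ * Kδ * (X * Y) * M) := by
  have e1 : |P₁ * P₂| ≤ Kα * E * Wp * (Kα * E * Wu) := by rw [abs_mul]; exact mul_le_mul b1 b2 (abs_nonneg _) (by positivity)
  have e2 : |P₃ * P₄| ≤ Kγ * X * E * (Kδ * Y * M) := by rw [abs_mul]; exact mul_le_mul b3 b4 (abs_nonneg _) (by positivity)
  have e3 : |P₅ * P₆| ≤ Kδ * Y * M * (Kγ * X * E) := by rw [abs_mul]; exact mul_le_mul b5 b6 (abs_nonneg _) (by positivity)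
  have e4 : |P₇ * P₈| ≤ Kβ * E * Wu * (Kβ * E * Wp) := by rw [abs_mul]; exact mul_le_mul b7 b8 (abs_nonneg _) (by positivity)
  have hEE : E * E ≤ E := by nlinarith
  calc |-(1 / 2 : ℝ) * (P₁ * P₂ - P₃ * P₄ - (P₅ * P₆ - P₇ * P₈))|
      = (1 / 2) * |P₁ * P₂ - P₃ * P₄ - (P₅ * P₆ - P₇ * P₈)| := by
        rw [abs_mul, abs_neg, abs_of_pos (by norm_num : (0 : ℝ) < 1 / 2)]
    _ ≤ (1 / 2) * (|P₁ * P₂| + |P₃ * P₄| + (|P₅ * P₆| + |P₇ * P₈|)) := by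
        refine mul_le_mul_of_nonneg_left ?_ (by norm_num)
        exact (abs_sub _ _).trans (add_le_add (abs_sub _ _) (abs_sub _ _))
    _ ≤ (1 / 2) * (Kα * E * Wp * (Kα * E * Wu) + Kγ * X * E * (Kδ * Y * M) + (Kδ * Y * M * (Kγ * X * E) + Kβ * E * Wu * (Kβ * E * Wp))) := by
        gcongr
    _ = (1 / 2) * ((Kα * Kα + Kβ * Kβ) * (E * E) * (Wp * Wu) + 2 * Kγ * Kδ * (X * Y) * E * M) := by ring
    _ ≤ 1 * ((Kα * Kα + Kβ * Kβ) * E * (Wp * Wu) + 2 * Kγ * Kδ * (X * Y) * E * M) := by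
        refine mul_le_mul (by norm_num) (add_le_add ?_ le_rfl) (by positivity) (by norm_num)
        exact mul_le_mul_of_nonneg_right (mul_le_mul_of_nonneg_left hEE (by positivity)) (by positivity)
    _ = E * ((Kα * Kα + Kβ * Kβ) * (Wp * Wu) + 2 * Kγ * Kδ * (X * Y) * M) := by ring

/-- [folklore] **THE `ndl ⊗ ndl` WORD FROM THE FOUR PAIRING BOUNDS** (fixed `n`; `a > 0`; spread leg): with `W(κ,p) := Σ_{s∈B(blk p)} |qJet_p s|`,
`M(p,u) := Σ_{s,s′} |qJet_p s|·|qJet_u s′|∕nrm(s−s′)` and `E(p,u) := e^{−m·dist(blk p, blk u)}`, bounds `Kα·E·W` (needle outside), `Kβ·E·W` (needle inside),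
`Kγ·X·E` (column × column), `Kδ·Y·M` (needle × needle) on the four pairings give
`|biBubbleTable (Ga)(Ga) ndl ndl μ ν p u| ≤ E(p,u)·((Kα² + Kβ²)·W(μ,p)·W(ν,u) + 2·Kγ·Kδ·(X·Y)·M(p,u))`
(`NeedleNdlShape.ndlPiece_eq_dSw_tensor` on the base stencil, `bubble_sub_right`, `bubble_ndl_dSw` twice, `pairing_comm` for the transposed placements). -/
theorem abs_word_le_of_pairings (ha : 0 < a) (hA : Spr (Ga n a)) {Kα Kβ Kγ Kδ X Y m : ℝ} (hKα : 0 ≤ Kα) (hKβ : 0 ≤ Kβ) (hKγ : 0 ≤ Kγ)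
    (hKδ : 0 ≤ Kδ) (hX : 0 ≤ X) (hY : 0 ≤ Y) (hm : 0 ≤ m)
    (hrc : ∀ (κ : Fin 4) (p u : Site 4), |pairing (grad (ndlRow n a κ p))
        (applyK (Ga n a) (grad (fun q => cQ * (∑ z ∈ B (n - 1) (blk (n - 1) u), Pgt n a z q () ()) - kerP (d := 4) (n - 1) a q (blk (n - 1) u))))|
      ≤ Kα * Real.exp (-(m * dist (blk (n - 1) p) (blk (n - 1) u))) * ∑ s ∈ B (n - 1) (blk (n - 1) p), |qJet n κ p (blk (n - 1) p) s|)
    (hcr : ∀ (κ : Fin 4) (p u : Site 4),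
      |pairing (grad (fun q => cQ * (∑ z ∈ B (n - 1) (blk (n - 1) p), Pgt n a z q () ()) - kerP (d := 4) (n - 1) a q (blk (n - 1) p)))
          (applyK (Ga n a) (grad (ndlRow n a κ u)))|
        ≤ Kβ * Real.exp (-(m * dist (blk (n - 1) p) (blk (n - 1) u))) * ∑ s ∈ B (n - 1) (blk (n - 1) u), |qJet n κ u (blk (n - 1) u) s|)
    (hcc : ∀ (p u : Site 4),
      |pairing (grad (fun q => cQ * (∑ z ∈ B (n - 1) (blk (n - 1) p), Pgt n a z q () ()) - kerP (d := 4) (n - 1) a q (blk (n - 1) p)))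
          (applyK (Ga n a) (grad (fun q => cQ * (∑ z ∈ B (n - 1) (blk (n - 1) u), Pgt n a z q () ()) - kerP (d := 4) (n - 1) a q (blk (n - 1) u))))|
        ≤ Kγ * X * Real.exp (-(m * dist (blk (n - 1) p) (blk (n - 1) u))))
    (hrr : ∀ (κ κ' : Fin 4) (p u : Site 4), |pairing (grad (ndlRow n a κ p)) (applyK (Ga n a) (grad (ndlRow n a κ' u)))|
      ≤ Kδ * Y * ∑ s ∈ B (n - 1) (blk (n - 1) p), ∑ s' ∈ B (n - 1) (blk (n - 1) u),
          |qJet n κ p (blk (n - 1) p) s| * |qJet n κ' u (blk (n - 1) u) s'| / nrm (s - s'))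
    (μ ν : Fin 4) (p u : Site 4) :
    |biBubbleTable (Ga n a) (Ga n a) (ndlPiece n a cQ) (ndlPiece n a cQ) μ ν p u|
      ≤ Real.exp (-(m * dist (blk (n - 1) p) (blk (n - 1) u))) *
          ((Kα * Kα + Kβ * Kβ) *
              ((∑ s ∈ B (n - 1) (blk (n - 1) p), |qJet n μ p (blk (n - 1) p) s|) * (∑ s ∈ B (n - 1) (blk (n - 1) u), |qJet n ν u (blk (n - 1) u) s|))
            + 2 * Kγ * Kδ * (X * Y) * ∑ s ∈ B (n - 1) (blk (n - 1) p), ∑ s' ∈ B (n - 1) (blk (n - 1) u),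
                |qJet n μ p (blk (n - 1) p) s| * |qJet n ν u (blk (n - 1) u) s'| / nrm (s - s')) := by
  have hE0 : 0 ≤ Real.exp (-(m * dist (blk (n - 1) p) (blk (n - 1) u))) := (Real.exp_pos _).le
  have hE1 : Real.exp (-(m * dist (blk (n - 1) p) (blk (n - 1) u))) ≤ 1 := by
    rw [Real.exp_le_one_iff]; have : 0 ≤ m * dist (blk (n - 1) p) (blk (n - 1) u) := by positivity
    linarith
  have hEs : Real.exp (-(m * dist (blk (n - 1) u) (blk (n - 1) p))) = Real.exp (-(m * dist (blk (n - 1) p) (blk (n - 1) u))) := by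
    rw [dist_comm]
  have hWp0 : 0 ≤ ∑ s ∈ B (n - 1) (blk (n - 1) p), |qJet n μ p (blk (n - 1) p) s| := Finset.sum_nonneg fun s _ => abs_nonneg _
  have hWu0 : 0 ≤ ∑ s ∈ B (n - 1) (blk (n - 1) u), |qJet n ν u (blk (n - 1) u) s| := Finset.sum_nonneg fun s _ => abs_nonneg _
  have hM0 : 0 ≤ ∑ s ∈ B (n - 1) (blk (n - 1) p), ∑ s' ∈ B (n - 1) (blk (n - 1) u),
      |qJet n μ p (blk (n - 1) p) s| * |qJet n ν u (blk (n - 1) u) s'| / nrm (s - s') :=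
    Finset.sum_nonneg fun s _ => Finset.sum_nonneg fun s' _ => by have := nrm_pos (s - s'); positivity
  have hMs : ∑ s' ∈ B (n - 1) (blk (n - 1) u), ∑ s ∈ B (n - 1) (blk (n - 1) p),
      |qJet n ν u (blk (n - 1) u) s'| * |qJet n μ p (blk (n - 1) p) s| / nrm (s' - s) =
      ∑ s ∈ B (n - 1) (blk (n - 1) p), ∑ s' ∈ B (n - 1) (blk (n - 1) u),
        |qJet n μ p (blk (n - 1) p) s| * |qJet n ν u (blk (n - 1) u) s'| / nrm (s - s') := sum_sum_div_nrm_comm _ _ _ _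
  -- the word as eight pairings
  have hr := locV_ndlRow n a ν u ha
  have hc := locV_combinedColumn n a cQ u ha
  have hsplit : bubble (Ga n a) (ndlPiece n a cQ μ p) (ndlPiece n a cQ ν u) =
      bubble (Ga n a) (ndlPiece n a cQ μ p)
          (dSw (tensor (fun q => cQ * (∑ z ∈ B (n - 1) (blk (n - 1) u), Pgt n a z q () ()) - kerP (d := 4) (n - 1) a q (blk (n - 1) u)) (ndlRow n a ν u)))
        - bubble (Ga n a) (ndlPiece n a cQ μ p)
          (dSw (tensor (ndlRow n a ν u) (fun q => cQ * (∑ z ∈ B (n - 1) (blk (n - 1) u), Pgt n a z q () ()) - kerP (d := 4) (n - 1) a q (blk (n - 1) u)))) := by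
    rw [ndlPiece_eq_dSw_tensor n a cQ ν u ha, dSw_sub]
    exact bubble_sub_right hA (loc_ndlPiece n a cQ μ p ha) (loc_dSw_tensor hc hr) (loc_dSw_tensor hr hc)
  have h1 := bubble_ndl_dSw (n := n) (a := a) (cQ := cQ) (κ := μ) (u := p) ha hA hc hr
  have h2 := bubble_ndl_dSw (n := n) (a := a) (cQ := cQ) (κ := μ) (u := p) ha hA hr hc
  -- the eight bounds in the displayed currency
  have b2 := hrc ν u p
  rw [hEs, pairing_comm] at b2
  have b4 := hrr ν μ u p
  rw [hMs, pairing_comm] at b4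
  have b6 := hcc u p
  rw [hEs, pairing_comm] at b6
  have b8 := hcr μ u p
  rw [hEs, pairing_comm] at b8
  have key := word_arith hKα hKβ hKγ hKδ hX hY hE0 hE1 hWp0 hWu0 hM0 (hrc μ p u) b2 (hcc p u) b4 (hrr μ ν p u) b6 (hcr ν p u) b8
  rw [biBubbleTable_apply, ← bubble_eq_biBubble, hsplit, h1, h2]
  exact key

/-! ## §2 The cell (census from `NeedleNdlNdlCensus`) -/

/-- [folklore] **«GN-33 ∕ NN»: THE `ndlPiece ⊗ ndlPiece` CELL OF T₃ IS n-UNIFORM**, modulo [B5, Prop. 1.2] ∧ [B5, (1.126)–(1.127)] BY NAME and a uniform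
bound on the column weight (P13: `cQ n = cgh·a` enters only through `cQ₀`): one `C ≥ 0` with
`|cellSum n a (ndlPiece n a (cQ n)) (ndlPiece n a (cQ n)) μ ν| ≤ C` for every `n ≥ 1`. -/
theorem exists_ndlNdl_row_le (ha : 0 < a) (h12 : B5.Prop12Printed (fam nOf hn1 MOf a ha)) (h126 : B5.Kernel126_127Printed (kfam nOf MOf))
    {cQ : ℕ → ℝ} {cQ₀ : ℝ} (hcQ : ∀ n, |cQ n| ≤ cQ₀) (μ ν : Fin 4) :
    ∃ C : ℝ, 0 ≤ C ∧ ∀ (n : ℕ) [NeZero n], |cellSum n a (ndlPiece n a (cQ n)) (ndlPiece n a (cQ n)) μ ν| ≤ C := by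
  obtain ⟨kG, δG, hδG, hkG, hprof⟩ := exists_abs_Ga_le_profile a ha h12 h126
  obtain ⟨Kα, hKα, hrc⟩ := exists_row_col_bound a ha hkG hδG cQ₀
  obtain ⟨Kβ, hKβ, hcr⟩ := exists_col_row_bound a ha hkG hδG cQ₀
  obtain ⟨Kγ, hKγ, hcc⟩ := exists_col_col_bound a ha hkG hδG cQ₀
  obtain ⟨Kδ, hKδ, hrr⟩ := exists_row_row_bound a ha hkG hδG
  have hPP := deltaPP_pos 4 ha; have hP := deltaP_pos 4 ha; have hdR := dR_pos ha
  set m : ℝ := min (dR a / 2) (min δG (min (deltaPP 4 a) (deltaP 4 a))) / 4 with hm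
  have hm0 : 0 < m := by
    rw [hm]; exact div_pos (lt_min (half_pos hdR) (lt_min hδG (lt_min hPP hP))) (by norm_num)
  set c₁ : ℝ := Real.exp 1 * (2 * (0 : ℕ).factorial * (2 / (1 : ℝ)) ^ 0 *
    (1 + 2 * (4 : ℕ) * 3 ^ (4 - 1) * ((4 - 1 - 1).factorial * (4 / (1 : ℝ)) ^ (4 - 1 - 1) * (1 + 4 / (1 : ℝ))))) with hc₁
  have hc₁0 : 0 ≤ c₁ := by positivity
  set K₁ : ℝ := Kα * Kα + Kβ * Kβ with hK₁
  set K₂ : ℝ := 2 * Kγ * Kδ with hK₂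
  have hK4 := latticeConst_nonneg 4 (half_pos hm0).le
  refine ⟨(1 + 4 / m) ^ 2 * (((K₁ + K₂ * c₁) * latticeConst 4 (m / 2))), by positivity, fun n _ => ?_⟩
  have hn : (0 : ℝ) < n := by exact_mod_cast Nat.pos_of_ne_zero (NeZero.ne n)
  have hn1 : (1 : ℝ) ≤ n := by exact_mod_cast NeZero.one_le
  have hA : Spr (Ga n a) := spr_Ga_of_prop12 (a := a) (ha := ha) h12 h126 n
  have hG : ∀ (x y : Pt) (κ l : Fin 4),
      |Ga n a x y κ l| ≤ kG * Real.exp (-(δG / n) * Beta.PoissonInterior.supNorm (y - x)) / nrm (y - x) ^ 2 := fun x y κ l => hprof n x y κ l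
  -- the word bound at this `n` (X = n⁴, Y = n⁻³)
  have hword := abs_word_le_of_pairings n (cQ n) ha hA hKα hKβ hKγ hKδ (by positivity : (0 : ℝ) ≤ (n : ℝ) ^ 4)
    (by positivity : (0 : ℝ) ≤ ((n : ℝ) ^ 3)⁻¹) hm0.le (hrc n (cQ n) (hcQ n) hG) (hcr n (cQ n) (hcQ n) hG)
    (fun p u => hcc n (cQ n) (hcQ n) hG p u) (fun κ κ' p u => hrr n hG κ κ' p u) μ ν
  have hXY : (n : ℝ) ^ 4 * ((n : ℝ) ^ 3)⁻¹ = n := by field_simp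
  -- per base site: block decay × block mass
  have hsite : ∀ b : Pt, |fullSum (fun w : Pt => toReal w μ * toReal w ν *
      biBubbleTable (Ga n a) (Ga n a) (ndlPiece n a (cQ n)) (ndlPiece n a (cQ n)) μ ν (b + w) b)|
      ≤ 1 * ((n : ℝ) ^ 2 * ((1 + 4 / m) ^ 2 *
          (((K₁ + K₂ * c₁) * n * ∑ s ∈ B (n - 1) (blk (n - 1) b), |qJet n ν b (blk (n - 1) b) s|) * latticeConst 4 (m / 2)))) := by
    intro b
    have hWb0 : 0 ≤ ∑ s ∈ B (n - 1) (blk (n - 1) b), |qJet n ν b (blk (n - 1) b) s| := Finset.sum_nonneg fun s _ => abs_nonneg _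
    have hF0 : ∀ p : Site 4, 0 ≤ K₁ * ((∑ s ∈ B (n - 1) (blk (n - 1) p), |qJet n μ p (blk (n - 1) p) s|) *
          (∑ s ∈ B (n - 1) (blk (n - 1) b), |qJet n ν b (blk (n - 1) b) s|))
        + K₂ * ((n : ℝ) ^ 4 * ((n : ℝ) ^ 3)⁻¹) * ∑ s ∈ B (n - 1) (blk (n - 1) p), ∑ s' ∈ B (n - 1) (blk (n - 1) b),
            |qJet n μ p (blk (n - 1) p) s| * |qJet n ν b (blk (n - 1) b) s'| / nrm (s - s') := fun p => by
      have h1 : 0 ≤ ∑ s ∈ B (n - 1) (blk (n - 1) p), |qJet n μ p (blk (n - 1) p) s| := Finset.sum_nonneg fun s _ => abs_nonneg _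
      have h2 : 0 ≤ ∑ s ∈ B (n - 1) (blk (n - 1) p), ∑ s' ∈ B (n - 1) (blk (n - 1) b),
          |qJet n μ p (blk (n - 1) p) s| * |qJet n ν b (blk (n - 1) b) s'| / nrm (s - s') :=
        Finset.sum_nonneg fun s _ => Finset.sum_nonneg fun s' _ => by have := nrm_pos (s - s'); positivity
      positivity
    -- block sums
    have hmass : ∀ β' : Site 4, ∑ p ∈ B (n - 1) β', (K₁ * ((∑ s ∈ B (n - 1) (blk (n - 1) p), |qJet n μ p (blk (n - 1) p) s|) *
          (∑ s ∈ B (n - 1) (blk (n - 1) b), |qJet n ν b (blk (n - 1) b) s|))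
        + K₂ * ((n : ℝ) ^ 4 * ((n : ℝ) ^ 3)⁻¹) * ∑ s ∈ B (n - 1) (blk (n - 1) p), ∑ s' ∈ B (n - 1) (blk (n - 1) b),
            |qJet n μ p (blk (n - 1) p) s| * |qJet n ν b (blk (n - 1) b) s'| / nrm (s - s'))
        ≤ (K₁ + K₂ * c₁) * n * ∑ s ∈ B (n - 1) (blk (n - 1) b), |qJet n ν b (blk (n - 1) b) s| := by
      intro β'
      rw [Finset.sum_add_distrib, ← Finset.mul_sum, ← Finset.mul_sum, ← Finset.sum_mul, hXY]
      have h1 := sum_B_W_le n μ β'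
      have h2 := sum_B_M_le n μ ν β' b
      have h3 : (n : ℝ) ^ 3 * (((n : ℝ) - 1) * ((n : ℝ) ^ 4)⁻¹) ≤ 1 := by
        rw [show (n : ℝ) ^ 3 * (((n : ℝ) - 1) * ((n : ℝ) ^ 4)⁻¹) = ((n : ℝ) - 1) / n by field_simp]
        rw [div_le_one hn]; linarith
      set Wb := ∑ s ∈ B (n - 1) (blk (n - 1) b), |qJet n ν b (blk (n - 1) b) s|
      calc K₁ * ((∑ p ∈ B (n - 1) β', ∑ s ∈ B (n - 1) (blk (n - 1) p), |qJet n μ p (blk (n - 1) p) s|) * Wb)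
            + K₂ * (n : ℝ) * ∑ p ∈ B (n - 1) β', ∑ s ∈ B (n - 1) (blk (n - 1) p), ∑ s' ∈ B (n - 1) (blk (n - 1) b),
                |qJet n μ p (blk (n - 1) p) s| * |qJet n ν b (blk (n - 1) b) s'| / nrm (s - s')
          ≤ K₁ * (((n : ℝ) - 1) * Wb) + K₂ * (n : ℝ) * (c₁ * (n : ℝ) ^ 3 * (((n : ℝ) - 1) * ((n : ℝ) ^ 4)⁻¹) * Wb) := by
            gcongr
        _ = K₁ * (((n : ℝ) - 1) * Wb) + K₂ * c₁ * (n : ℝ) * ((n : ℝ) ^ 3 * (((n : ℝ) - 1) * ((n : ℝ) ^ 4)⁻¹)) * Wb := by ring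
        _ ≤ K₁ * ((n : ℝ) * Wb) + K₂ * c₁ * (n : ℝ) * 1 * Wb := by
            gcongr
            linarith
        _ = (K₁ + K₂ * c₁) * n * Wb := by ring
    have hf : ∀ w : Pt, |biBubbleTable (Ga n a) (Ga n a) (ndlPiece n a (cQ n)) (ndlPiece n a (cQ n)) μ ν (b + w) b|
        ≤ 1 * Real.exp (-(m * dist (blk (n - 1) (b + w)) (blk (n - 1) b))) *
          (K₁ * ((∑ s ∈ B (n - 1) (blk (n - 1) (b + w)), |qJet n μ (b + w) (blk (n - 1) (b + w)) s|) *
              (∑ s ∈ B (n - 1) (blk (n - 1) b), |qJet n ν b (blk (n - 1) b) s|))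
            + K₂ * ((n : ℝ) ^ 4 * ((n : ℝ) ^ 3)⁻¹) * ∑ s ∈ B (n - 1) (blk (n - 1) (b + w)), ∑ s' ∈ B (n - 1) (blk (n - 1) b),
                |qJet n μ (b + w) (blk (n - 1) (b + w)) s| * |qJet n ν b (blk (n - 1) b) s'| / nrm (s - s')) := by
      intro w
      rw [one_mul]
      exact hword (b + w) b
    exact abs_fullSum_weight_le_of_blockDecay_mass n zero_le_one hm0 hF0 hmass b μ ν hf
  -- the base average
  rw [cellSum_def]
  have hbase := sum_resSite_W_le n ν
  calc |∑ b ∈ (univ : Finset (Fin 4 → Fin n)).image resSite, ((n : ℝ) ^ 4)⁻¹ *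
        fullSum (fun w : Pt => toReal w μ * toReal w ν *
          biBubbleTable (Ga n a) (Ga n a) (ndlPiece n a (cQ n)) (ndlPiece n a (cQ n)) μ ν (b + w) b)|
      ≤ ∑ b ∈ (univ : Finset (Fin 4 → Fin n)).image resSite, |((n : ℝ) ^ 4)⁻¹ *
          fullSum (fun w : Pt => toReal w μ * toReal w ν *
            biBubbleTable (Ga n a) (Ga n a) (ndlPiece n a (cQ n)) (ndlPiece n a (cQ n)) μ ν (b + w) b)| :=
        Finset.abs_sum_le_sum_abs _ _
    _ ≤ ∑ b ∈ (univ : Finset (Fin 4 → Fin n)).image resSite, ((n : ℝ) ^ 4)⁻¹ * (1 * ((n : ℝ) ^ 2 * ((1 + 4 / m) ^ 2 *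
          (((K₁ + K₂ * c₁) * n * ∑ s ∈ B (n - 1) (blk (n - 1) b), |qJet n ν b (blk (n - 1) b) s|) * latticeConst 4 (m / 2))))) := by
        refine Finset.sum_le_sum fun b _ => ?_
        rw [abs_mul, abs_of_nonneg (by positivity : (0 : ℝ) ≤ ((n : ℝ) ^ 4)⁻¹)]
        exact mul_le_mul_of_nonneg_left (hsite b) (by positivity)
    _ = (1 + 4 / m) ^ 2 * ((K₁ + K₂ * c₁) * latticeConst 4 (m / 2)) * ((n : ℝ)⁻¹ *
          ∑ b ∈ (univ : Finset (Fin 4 → Fin n)).image resSite, ∑ s ∈ B (n - 1) (blk (n - 1) b), |qJet n ν b (blk (n - 1) b) s|) := by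
        rw [Finset.mul_sum, Finset.mul_sum]
        refine Finset.sum_congr rfl fun b _ => ?_
        field_simp
    _ ≤ (1 + 4 / m) ^ 2 * ((K₁ + K₂ * c₁) * latticeConst 4 (m / 2)) * 1 := by
        refine mul_le_mul_of_nonneg_left ?_ (by positivity)
        rw [inv_mul_le_iff₀ hn, mul_one]
        linarith
    _ = _ := mul_one _

/-- [folklore] **THE HYPOTHESIS `hnn` OF `GluonNeedleGlue.h₃_of_cells` VERBATIM** (the `2 ≤ n` form is a fortiori). -/
theorem hnn_of_prop12 (ha : 0 < a) (h12 : B5.Prop12Printed (fam nOf hn1 MOf a ha)) (h126 : B5.Kernel126_127Printed (kfam nOf MOf))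
    {cQ : ℕ → ℝ} {cQ₀ : ℝ} (hcQ : ∀ n, |cQ n| ≤ cQ₀) (μ ν : Fin 4) :
    ∃ Cnn : ℝ, 0 ≤ Cnn ∧ ∀ n : ℕ, 2 ≤ n → ∀ [NeZero n], |cellSum n a (ndlPiece n a (cQ n)) (ndlPiece n a (cQ n)) μ ν| ≤ Cnn := by
  obtain ⟨C, hC, h⟩ := exists_ndlNdl_row_le ha h12 h126 hcQ μ ν
  exact ⟨C, hC, fun n _ _ => h n⟩

end Summit.QuantumFields.BalabanUV.Beta.D1BFx.NeedleNdlNdlRow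

end
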